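import Summits.Ventures.YMGap.Thresholds.OneLinkLevelTwoBootTildeEnvelope
import Summits.Ventures.YMGap.Thresholds.OneLinkLevelTwoBootRows
import Summits.Ventures.YMGap.Thresholds.StarMassGapDimRows
import HarnessLib

/-!
# Venture YMGap — the one-link modulus beyond first order, part 56: the `ω̃` bootstrap modulus `K₂BT` through the any-`d` star
# socket — the `d = 3` ladder `ImprovedThreshold 3 N (36/625 | 159/2500 | 42/625 | 69/1000 | 87/1250)` for `N ≥ 4 | 6 | 10 | 20 | 50`,
# and rows in `d = 5, 6, 7, 8`

HONEST FRAMING: venture file of the cell `pub-ymgap` (QuantumFields programme), strong-coupling LATTICE statements for `SU(N)`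
lattice Yang–Mills on `ℤ^d` with the Wilson action (tree coupling `N·x`, 't Hooft coupling `x`); nothing about the continuum,
confinement at weak coupling, or the Millennium problem; no decay rate beyond `∃ c > 0`.  Kernel ARITHMETIC over tree theorems,
exactly as `OneLinkLevelTwoBootDimRows` (ds-1's any-`d` star socket `StarDimMassGap.massGapAt_of_oneLinkKRModulus`, door
`P_d(K|x|) < 1`, `P_d(c) = (4d−4)c² + (4d−6)c`, tilt ball `R₀ = 2(d−1)a ≥ 2(d−1)|x|`), with the `ω̃` bootstrap modulus at a rational
bracket (`oneLinkKRModulus_levelTwoBT_bracket` of `OneLinkLevelTwoBootTildeRows`, copied here as a private helper; door closed by `norm_num [doorPoly]` on the unification-produced constant).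

OUTPUT (hypothesis-free, kernel-checked, two-sided in `x`):
* `d = 3` (sharp Bakry–Émery `1/24`): `N ≥ 4`: `36 / 625 = 0.0576` (`K₂B` `143/2500`) · `N ≥ 6`: `159 / 2500 = 0.0636` (`K₂B` `1/16`) · `N ≥ 10`: `42 / 625 = 0.0672` (`K₂B` `41/625`) · `N ≥ 20`: `69 / 1000 = 0.0690` (`K₂B` `67/1000`) · `N ≥ 50`: `87 / 1250 = 0.0696` (`K₂B` `—`);
* `d = 5` (sharp Bakry–Émery `1/40`): `N ≥ 6`: `39 / 1250 = 0.0312` (`K₂B` `61/2000`) · `N ≥ 10`: `33 / 1000 = 0.0330` (`K₂B` `4/125`) · `N ≥ 20`: `21 / 625 = 0.0336` (`K₂B` `41/1250`) · `N ≥ 50`: `41 / 1200 = 0.0342` (`K₂B` `—`);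
* `d = 6` (sharp Bakry–Émery `1/48`): `N ≥ 6`: `31 / 1250 = 0.0248` (`K₂B` `49/2000`) · `N ≥ 10`: `13 / 500 = 0.0260` (`K₂B` `16/625`) · `N ≥ 20`: `27 / 1000 = 0.0270` (`K₂B` `13/500`) · `N ≥ 50`: `17 / 625 = 0.0272` (`K₂B` `—`);
* `d = 7` (sharp Bakry–Émery `1/56`): `N ≥ 10`: `13 / 600 = 0.0217` (`K₂B` `53/2500`) · `N ≥ 20`: `14 / 625 = 0.0224` (`K₂B` `27/1250`) · `N ≥ 50`: `9 / 400 = 0.0225` (`K₂B` `—`);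
* `d = 8` (sharp Bakry–Émery `1/64`): `N ≥ 10`: `37 / 2000 = 0.0185` (`K₂B` `9/500`) · `N ≥ 20`: `12 / 625 = 0.0192` (`K₂B` `37/2000`);
Sentence-grade rows (cell ruling R140(b) class K); the `d = 4` rows are `OneLinkLevelTwoBootTildeRows`.  Exact rationals: cell folder
`work/hier/rows_pick_bt.py` (margins `0.1–3.5 %`, exact rational arithmetic).
-/

noncomputable section

open scoped Matrix ComplexConjugate BigOperators ContDiff Matrix.Norms.Frobenius
open Matrix Complex Finset MeasureTheory ProbabilityTheory
open Literature.MathematicalPhysics.QuantumFieldTheory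
open Literature.MathematicalPhysics.QuantumFieldTheory.SUNBakryEmery
open Literature.MathematicalPhysics.QuantumFieldTheory.Balaban1983to89.StrongCouplingDobrushinWindow
open Literature.MathematicalPhysics.QuantumFieldTheory.Balaban1983to89.StrongCouplingKernelWindow

namespace Summit.Ventures.YMGap.OneLinkEigen

variable {N : ℕ}

section LevelTwoBTDimRows

open Summit.Ventures.YMGap.StarResolventDim (doorPoly doorPoly_lt_one_mono)
open Summit.Ventures.YMGap.OneLinkEigenRows (casimirFactor_le)

/-- (Local `private` copy of `OneLinkLevelTwoBootTildeRows.oneLinkKRModulus_levelTwoBT_bracket`, so that this file does not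
wait for that module's build.)  **The `ω̃`-bootstrap modulus at a rational bracket**: for `N ≥ N₀ ≥ 3`, `R₀ < 1/2` and rationals `q, p, t, u ≥ 0` with
`q² ≥ R₀²/4 + 1/N₀²`, `p² ≥ (1 + ω̄⁺)/2`, `t² ≥ b̄²/4 + c̄`, `u² ≥ (τ̄ + R₀²)²/16 + R₀²/N₀²`:
`OneLinkKRModulus N R₀ (K̄₂BT(N₀,R₀; q,p,t,u))`, `K̄₂BT = C(N₀)(p + E(N₀)R₀ + 2(E(N₀)+¼)ω̃̄ + ((3/2)E(N₀)R₀² + (2E(N₀)+¼)τ̄ + (10E(N₀)+½)R₀ω̃̄)/(½−R₀)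
+ (3/2)E(N₀)R₀²·K̄₂QT)` — the row socket (the constant is produced by unification, never written). [folklore] -/
private theorem levelTwoBT_bracket_local {N₀ : ℕ} (hN₀ : 3 ≤ N₀) (hN : N₀ ≤ N) {R₀ q p t u : ℝ} (hR0 : 0 ≤ R₀) (hR₀ : R₀ < 1 / 2)
    (hq : 0 ≤ q) (hq2 : R₀ ^ 2 / 4 + 1 / (N₀ : ℝ) ^ 2 ≤ q ^ 2) (hp : 0 ≤ p)
    (hp2 : (1 + ((2 * ((2 * (N₀ : ℝ) ^ 2 - 4) / (4 * (N₀ : ℝ) ^ 2 - 20)) * ((R₀) + ((R₀) ^ 2 / 2 + (R₀) * (q))) + 2 * (2 * (N₀ : ℝ) ^ 2 / (4 * (N₀ : ℝ) ^ 2 - 20)) * (((R₀) ^ 2 / 2 + (R₀) * (q)) + (R₀) * ((R₀) / 2 + (q)) ^ 2)))) / 2 ≤ p ^ 2) (ht : 0 ≤ t)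
    (ht2 : ((R₀) ^ 2 * (1 + (R₀) / 2 + (q)) / (2 - 4 / (N₀ : ℝ) ^ 2)) ^ 2 / 4 + ((R₀) ^ 2 * (4 / (N₀ : ℝ) ^ 2 + 2 * ((R₀) / 2 + (q)) ^ 2) / (2 - 4 / (N₀ : ℝ) ^ 2)) ≤ t ^ 2) (hu : 0 ≤ u)
    (hu2 : (((R₀) * (((R₀) ^ 2 * (1 + (R₀) / 2 + (q)) / (2 - 4 / (N₀ : ℝ) ^ 2)) / 2 + (t))) + R₀ ^ 2) ^ 2 / 16 + R₀ ^ 2 / (N₀ : ℝ) ^ 2 ≤ u ^ 2) :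
    OneLinkKRModulus N R₀
      (((N₀ : ℝ) ^ 2 / ((N₀ : ℝ) ^ 2 - 1)) *
        ((p) + ((N₀ : ℝ) ^ 2 / (2 * ((N₀ : ℝ) ^ 2 - 4))) * (R₀) + 2 * (((N₀ : ℝ) ^ 2 / (2 * ((N₀ : ℝ) ^ 2 - 4))) + 1 / 4) * ((((R₀) * (((R₀) ^ 2 * (1 + (R₀) / 2 + (q)) / (2 - 4 / (N₀ : ℝ) ^ 2)) / 2 + (t))) + (R₀) ^ 2) / 4 + (u))
          + (3 / 2 * ((N₀ : ℝ) ^ 2 / (2 * ((N₀ : ℝ) ^ 2 - 4))) * (R₀) ^ 2 + (2 * ((N₀ : ℝ) ^ 2 / (2 * ((N₀ : ℝ) ^ 2 - 4))) + 1 / 4) * ((R₀) * (((R₀) ^ 2 * (1 + (R₀) / 2 + (q)) / (2 - 4 / (N₀ : ℝ) ^ 2)) / 2 + (t)))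
              + (10 * ((N₀ : ℝ) ^ 2 / (2 * ((N₀ : ℝ) ^ 2 - 4))) + 1 / 2) * (R₀) * ((((R₀) * (((R₀) ^ 2 * (1 + (R₀) / 2 + (q)) / (2 - 4 / (N₀ : ℝ) ^ 2)) / 2 + (t))) + (R₀) ^ 2) / 4 + (u))) / (1 / 2 - (R₀))
          + 3 / 2 * ((N₀ : ℝ) ^ 2 / (2 * ((N₀ : ℝ) ^ 2 - 4))) * (R₀) ^ 2 * (((N₀ : ℝ) ^ 2 / ((N₀ : ℝ) ^ 2 - 1)) *
        ((p) + ((N₀ : ℝ) ^ 2 / (2 * ((N₀ : ℝ) ^ 2 - 4))) * (R₀) + 2 * (((N₀ : ℝ) ^ 2 / (2 * ((N₀ : ℝ) ^ 2 - 4))) + 1 / 4) * ((((R₀) * (((R₀) ^ 2 * (1 + (R₀) / 2 + (q)) / (2 - 4 / (N₀ : ℝ) ^ 2)) / 2 + (t))) + (R₀) ^ 2) / 4 + (u))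
          + (3 * ((N₀ : ℝ) ^ 2 / (2 * ((N₀ : ℝ) ^ 2 - 4))) * (R₀) ^ 2 + (2 * ((N₀ : ℝ) ^ 2 / (2 * ((N₀ : ℝ) ^ 2 - 4))) + 1 / 4) * ((R₀) * (((R₀) ^ 2 * (1 + (R₀) / 2 + (q)) / (2 - 4 / (N₀ : ℝ) ^ 2)) / 2 + (t)))
              + (10 * ((N₀ : ℝ) ^ 2 / (2 * ((N₀ : ℝ) ^ 2 - 4))) + 1 / 2) * (R₀) * ((((R₀) * (((R₀) ^ 2 * (1 + (R₀) / 2 + (q)) / (2 - 4 / (N₀ : ℝ) ^ 2)) / 2 + (t))) + (R₀) ^ 2) / 4 + (u))) / (1 / 2 - (R₀)))))) :=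
  oneLinkKRModulus_levelTwoBT_of_le (le_trans hN₀ hN) le_rfl hR₀ (casimirFactor_le (by omega) hN) (levelTwoE_le hN₀ hN)
    (sqrt_omegaPlus_le hN₀ hN hR0 le_rfl hq hq2 hp hp2) (omegaTilde_le hN₀ hN hR0 le_rfl hq hq2 ht ht2 hu hu2)
    (tau_le hN₀ hN hR0 le_rfl hq hq2 ht ht2) (levelTwoQTK_le hN₀ hN hR0 le_rfl hR₀ hq hq2 hp hp2 ht ht2 hu hu2)


/-- Door arithmetic for the any-`d` socket: `0 ≤ K`, `|x| ≤ a`, `P_d(K·a) < 1` give `P_d(K·|x|) < 1`. [folklore] -/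
theorem dim_door_of_le {d : ℕ} (hd : 2 ≤ d) {K b a : ℝ} (hK0 : 0 ≤ K) (hb : b ≤ a) (hb0 : 0 ≤ b)
    (h : doorPoly d (K * a) < 1) : doorPoly d (K * b) < 1 :=
  doorPoly_lt_one_mono hd (mul_nonneg hK0 hb0) (mul_le_mul_of_nonneg_left hb hK0) h

/-! ### `d = 3` -/

/-- **`SU(N)`, `N ≥ 4`, `d = 3`**: `MassGapAt 3 N x` at every 't Hooft `|x| ≤ 36 / 625 = 0.0576`, hypothesis-free (bracket `N₀ = 4`,
`R₀ = 144 / 625`, `q = 2753 / 10000`, `p = 2229 / 2500`, `t = 6573 / 50000`, `u = 771 / 12500`; `P_3(K̄₂BT·a) = 0.9802 < 1`; `K₂B` column `143/2500`, sharp Bakry–Émery `1/24`). [folklore] -/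
theorem massGapAt_SU_three_levelTwoBT_four (hN : 4 ≤ N) {x : ℝ} (h : |x| ≤ 36 / 625) : MassGapAt 3 N x := by
  have hR : |x| * (2 * (((3 : ℕ) : ℝ) - 1)) ≤ 144 / 625 := by push_cast; linarith only [h]
  have hmod := levelTwoBT_bracket_local (N₀ := 4) (N := N) (by norm_num) hN (R₀ := 144 / 625) (q := 2753 / 10000) (p := 2229 / 2500)
    (t := 6573 / 50000) (u := 771 / 12500) (by norm_num) (by norm_num) (by norm_num) (by norm_num) (by norm_num) (by norm_num) (by norm_num)
    (by norm_num) (by norm_num) (by norm_num)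
  refine StarDimMassGap.massGapAt_of_oneLinkKRModulus (d := 3) (by norm_num) (by omega) ?_ hR hmod
    (dim_door_of_le (d := 3) (by norm_num) ?_ h (abs_nonneg x) ?_) <;> norm_num [doorPoly]

/-- **`ImprovedThreshold 3 N (36 / 625)` for every `N ≥ 4`, hypothesis-free** (`0.0576`). [folklore] -/
theorem improvedThreshold_SU_three_levelTwoBT_four (hN : 4 ≤ N) : ImprovedThreshold 3 N (36 / 625) :=
  ⟨by norm_num, fun _ hx => massGapAt_SU_three_levelTwoBT_four hN hx.le⟩

/-- **`SU(N)`, `N ≥ 6`, `d = 3`**: `MassGapAt 3 N x` at every 't Hooft `|x| ≤ 159 / 2500 = 0.0636`, hypothesis-free (bracket `N₀ = 6`,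
`R₀ = 159 / 625`, `q = 2097 / 10000`, `p = 4339 / 5000`, `t = 2201 / 20000`, `u = 613 / 12500`; `P_3(K̄₂BT·a) = 0.9941 < 1`; `K₂B` column `1/16`, sharp Bakry–Émery `1/24`). [folklore] -/
theorem massGapAt_SU_three_levelTwoBT_six (hN : 6 ≤ N) {x : ℝ} (h : |x| ≤ 159 / 2500) : MassGapAt 3 N x := by
  have hR : |x| * (2 * (((3 : ℕ) : ℝ) - 1)) ≤ 159 / 625 := by push_cast; linarith only [h]
  have hmod := levelTwoBT_bracket_local (N₀ := 6) (N := N) (by norm_num) hN (R₀ := 159 / 625) (q := 2097 / 10000) (p := 4339 / 5000)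
    (t := 2201 / 20000) (u := 613 / 12500) (by norm_num) (by norm_num) (by norm_num) (by norm_num) (by norm_num) (by norm_num) (by norm_num)
    (by norm_num) (by norm_num) (by norm_num)
  refine StarDimMassGap.massGapAt_of_oneLinkKRModulus (d := 3) (by norm_num) (by omega) ?_ hR hmod
    (dim_door_of_le (d := 3) (by norm_num) ?_ h (abs_nonneg x) ?_) <;> norm_num [doorPoly]

/-- **`ImprovedThreshold 3 N (159 / 2500)` for every `N ≥ 6`, hypothesis-free** (`0.0636`). [folklore] -/
theorem improvedThreshold_SU_three_levelTwoBT_six (hN : 6 ≤ N) : ImprovedThreshold 3 N (159 / 2500) :=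
  ⟨by norm_num, fun _ hx => massGapAt_SU_three_levelTwoBT_six hN hx.le⟩

/-- **`SU(N)`, `N ≥ 10`, `d = 3`**: `MassGapAt 3 N x` at every 't Hooft `|x| ≤ 42 / 625 = 0.0672`, hypothesis-free (bracket `N₀ = 10`,
`R₀ = 168 / 625`, `q = 419 / 2500`, `p = 429 / 500`, `t = 1171 / 12500`, `u = 1869 / 50000`; `P_3(K̄₂BT·a) = 0.9962 < 1`; `K₂B` column `41/625`, sharp Bakry–Émery `1/24`). [folklore] -/
theorem massGapAt_SU_three_levelTwoBT_ten (hN : 10 ≤ N) {x : ℝ} (h : |x| ≤ 42 / 625) : MassGapAt 3 N x := by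
  have hR : |x| * (2 * (((3 : ℕ) : ℝ) - 1)) ≤ 168 / 625 := by push_cast; linarith only [h]
  have hmod := levelTwoBT_bracket_local (N₀ := 10) (N := N) (by norm_num) hN (R₀ := 168 / 625) (q := 419 / 2500) (p := 429 / 500)
    (t := 1171 / 12500) (u := 1869 / 50000) (by norm_num) (by norm_num) (by norm_num) (by norm_num) (by norm_num) (by norm_num) (by norm_num)
    (by norm_num) (by norm_num) (by norm_num)
  refine StarDimMassGap.massGapAt_of_oneLinkKRModulus (d := 3) (by norm_num) (by omega) ?_ hR hmod
    (dim_door_of_le (d := 3) (by norm_num) ?_ h (abs_nonneg x) ?_) <;> norm_num [doorPoly]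

/-- **`ImprovedThreshold 3 N (42 / 625)` for every `N ≥ 10`, hypothesis-free** (`0.0672`). [folklore] -/
theorem improvedThreshold_SU_three_levelTwoBT_ten (hN : 10 ≤ N) : ImprovedThreshold 3 N (42 / 625) :=
  ⟨by norm_num, fun _ hx => massGapAt_SU_three_levelTwoBT_ten hN hx.le⟩

/-- **`SU(N)`, `N ≥ 20`, `d = 3`**: `MassGapAt 3 N x` at every 't Hooft `|x| ≤ 69 / 1000 = 0.0690`, hypothesis-free (bracket `N₀ = 20`,
`R₀ = 69 / 250`, `q = 367 / 2500`, `p = 8543 / 10000`, `t = 2121 / 25000`, `u = 2997 / 100000`; `P_3(K̄₂BT·a) = 0.9934 < 1`; `K₂B` column `67/1000`, sharp Bakry–Émery `1/24`). [folklore] -/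
theorem massGapAt_SU_three_levelTwoBT_twenty (hN : 20 ≤ N) {x : ℝ} (h : |x| ≤ 69 / 1000) : MassGapAt 3 N x := by
  have hR : |x| * (2 * (((3 : ℕ) : ℝ) - 1)) ≤ 69 / 250 := by push_cast; linarith only [h]
  have hmod := levelTwoBT_bracket_local (N₀ := 20) (N := N) (by norm_num) hN (R₀ := 69 / 250) (q := 367 / 2500) (p := 8543 / 10000)
    (t := 2121 / 25000) (u := 2997 / 100000) (by norm_num) (by norm_num) (by norm_num) (by norm_num) (by norm_num) (by norm_num) (by norm_num)
    (by norm_num) (by norm_num) (by norm_num)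
  refine StarDimMassGap.massGapAt_of_oneLinkKRModulus (d := 3) (by norm_num) (by omega) ?_ hR hmod
    (dim_door_of_le (d := 3) (by norm_num) ?_ h (abs_nonneg x) ?_) <;> norm_num [doorPoly]

/-- **`ImprovedThreshold 3 N (69 / 1000)` for every `N ≥ 20`, hypothesis-free** (`0.0690`). [folklore] -/
theorem improvedThreshold_SU_three_levelTwoBT_twenty (hN : 20 ≤ N) : ImprovedThreshold 3 N (69 / 1000) :=
  ⟨by norm_num, fun _ hx => massGapAt_SU_three_levelTwoBT_twenty hN hx.le⟩

/-- **`SU(N)`, `N ≥ 50`, `d = 3`**: `MassGapAt 3 N x` at every 't Hooft `|x| ≤ 87 / 1250 = 0.0696`, hypothesis-free (bracket `N₀ = 50`,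
`R₀ = 174 / 625`, `q = 1407 / 10000`, `p = 1707 / 2000`, `t = 8219 / 100000`, `u = 137 / 5000`; `P_3(K̄₂BT·a) = 0.9938 < 1`; `K₂B` column `—`, sharp Bakry–Émery `1/24`). [folklore] -/
theorem massGapAt_SU_three_levelTwoBT_fifty (hN : 50 ≤ N) {x : ℝ} (h : |x| ≤ 87 / 1250) : MassGapAt 3 N x := by
  have hR : |x| * (2 * (((3 : ℕ) : ℝ) - 1)) ≤ 174 / 625 := by push_cast; linarith only [h]
  have hmod := levelTwoBT_bracket_local (N₀ := 50) (N := N) (by norm_num) hN (R₀ := 174 / 625) (q := 1407 / 10000) (p := 1707 / 2000)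
    (t := 8219 / 100000) (u := 137 / 5000) (by norm_num) (by norm_num) (by norm_num) (by norm_num) (by norm_num) (by norm_num) (by norm_num)
    (by norm_num) (by norm_num) (by norm_num)
  refine StarDimMassGap.massGapAt_of_oneLinkKRModulus (d := 3) (by norm_num) (by omega) ?_ hR hmod
    (dim_door_of_le (d := 3) (by norm_num) ?_ h (abs_nonneg x) ?_) <;> norm_num [doorPoly]

/-- **`ImprovedThreshold 3 N (87 / 1250)` for every `N ≥ 50`, hypothesis-free** (`0.0696`). [folklore] -/
theorem improvedThreshold_SU_three_levelTwoBT_fifty (hN : 50 ≤ N) : ImprovedThreshold 3 N (87 / 1250) :=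
  ⟨by norm_num, fun _ hx => massGapAt_SU_three_levelTwoBT_fifty hN hx.le⟩

/-! ### `d = 5` -/

/-- **`SU(N)`, `N ≥ 6`, `d = 5`**: `MassGapAt 5 N x` at every 't Hooft `|x| ≤ 39 / 1250 = 0.0312`, hypothesis-free (bracket `N₀ = 6`,
`R₀ = 156 / 625`, `q = 2083 / 10000`, `p = 4321 / 5000`, `t = 10709 / 100000`, `u = 957 / 20000`; `P_5(K̄₂BT·a) = 0.9957 < 1`; `K₂B` column `61/2000`, sharp Bakry–Émery `1/40`). [folklore] -/
theorem massGapAt_SU_five_levelTwoBT_six (hN : 6 ≤ N) {x : ℝ} (h : |x| ≤ 39 / 1250) : MassGapAt 5 N x := by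
  have hR : |x| * (2 * (((5 : ℕ) : ℝ) - 1)) ≤ 156 / 625 := by push_cast; linarith only [h]
  have hmod := levelTwoBT_bracket_local (N₀ := 6) (N := N) (by norm_num) hN (R₀ := 156 / 625) (q := 2083 / 10000) (p := 4321 / 5000)
    (t := 10709 / 100000) (u := 957 / 20000) (by norm_num) (by norm_num) (by norm_num) (by norm_num) (by norm_num) (by norm_num) (by norm_num)
    (by norm_num) (by norm_num) (by norm_num)
  refine StarDimMassGap.massGapAt_of_oneLinkKRModulus (d := 5) (by norm_num) (by omega) ?_ hR hmod
    (dim_door_of_le (d := 5) (by norm_num) ?_ h (abs_nonneg x) ?_) <;> norm_num [doorPoly]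

/-- **`ImprovedThreshold 5 N (39 / 1250)` for every `N ≥ 6`, hypothesis-free** (`0.0312`). [folklore] -/
theorem improvedThreshold_SU_five_levelTwoBT_six (hN : 6 ≤ N) : ImprovedThreshold 5 N (39 / 1250) :=
  ⟨by norm_num, fun _ hx => massGapAt_SU_five_levelTwoBT_six hN hx.le⟩

/-- **`SU(N)`, `N ≥ 10`, `d = 5`**: `MassGapAt 5 N x` at every 't Hooft `|x| ≤ 33 / 1000 = 0.0330`, hypothesis-free (bracket `N₀ = 10`,
`R₀ = 33 / 125`, `q = 1657 / 10000`, `p = 8547 / 10000`, `t = 284 / 3125`, `u = 3633 / 100000`; `P_5(K̄₂BT·a) = 0.9986 < 1`; `K₂B` column `4/125`, sharp Bakry–Émery `1/40`). [folklore] -/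
theorem massGapAt_SU_five_levelTwoBT_ten (hN : 10 ≤ N) {x : ℝ} (h : |x| ≤ 33 / 1000) : MassGapAt 5 N x := by
  have hR : |x| * (2 * (((5 : ℕ) : ℝ) - 1)) ≤ 33 / 125 := by push_cast; linarith only [h]
  have hmod := levelTwoBT_bracket_local (N₀ := 10) (N := N) (by norm_num) hN (R₀ := 33 / 125) (q := 1657 / 10000) (p := 8547 / 10000)
    (t := 284 / 3125) (u := 3633 / 100000) (by norm_num) (by norm_num) (by norm_num) (by norm_num) (by norm_num) (by norm_num) (by norm_num)
    (by norm_num) (by norm_num) (by norm_num)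
  refine StarDimMassGap.massGapAt_of_oneLinkKRModulus (d := 5) (by norm_num) (by omega) ?_ hR hmod
    (dim_door_of_le (d := 5) (by norm_num) ?_ h (abs_nonneg x) ?_) <;> norm_num [doorPoly]

/-- **`ImprovedThreshold 5 N (33 / 1000)` for every `N ≥ 10`, hypothesis-free** (`0.0330`). [folklore] -/
theorem improvedThreshold_SU_five_levelTwoBT_ten (hN : 10 ≤ N) : ImprovedThreshold 5 N (33 / 1000) :=
  ⟨by norm_num, fun _ hx => massGapAt_SU_five_levelTwoBT_ten hN hx.le⟩

/-- **`SU(N)`, `N ≥ 20`, `d = 5`**: `MassGapAt 5 N x` at every 't Hooft `|x| ≤ 21 / 625 = 0.0336`, hypothesis-free (bracket `N₀ = 20`,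
`R₀ = 168 / 625`, `q = 717 / 5000`, `p = 4247 / 5000`, `t = 4033 / 50000`, `u = 2843 / 100000`; `P_5(K̄₂BT·a) = 0.9678 < 1`; `K₂B` column `41/1250`, sharp Bakry–Émery `1/40`). [folklore] -/
theorem massGapAt_SU_five_levelTwoBT_twenty (hN : 20 ≤ N) {x : ℝ} (h : |x| ≤ 21 / 625) : MassGapAt 5 N x := by
  have hR : |x| * (2 * (((5 : ℕ) : ℝ) - 1)) ≤ 168 / 625 := by push_cast; linarith only [h]
  have hmod := levelTwoBT_bracket_local (N₀ := 20) (N := N) (by norm_num) hN (R₀ := 168 / 625) (q := 717 / 5000) (p := 4247 / 5000)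
    (t := 4033 / 50000) (u := 2843 / 100000) (by norm_num) (by norm_num) (by norm_num) (by norm_num) (by norm_num) (by norm_num) (by norm_num)
    (by norm_num) (by norm_num) (by norm_num)
  refine StarDimMassGap.massGapAt_of_oneLinkKRModulus (d := 5) (by norm_num) (by omega) ?_ hR hmod
    (dim_door_of_le (d := 5) (by norm_num) ?_ h (abs_nonneg x) ?_) <;> norm_num [doorPoly]

/-- **`ImprovedThreshold 5 N (21 / 625)` for every `N ≥ 20`, hypothesis-free** (`0.0336`). [folklore] -/
theorem improvedThreshold_SU_five_levelTwoBT_twenty (hN : 20 ≤ N) : ImprovedThreshold 5 N (21 / 625) :=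
  ⟨by norm_num, fun _ hx => massGapAt_SU_five_levelTwoBT_twenty hN hx.le⟩

/-- **`SU(N)`, `N ≥ 50`, `d = 5`**: `MassGapAt 5 N x` at every 't Hooft `|x| ≤ 41 / 1200 = 0.0342`, hypothesis-free (bracket `N₀ = 50`,
`R₀ = 41 / 150`, `q = 691 / 5000`, `p = 17 / 20`, `t = 7923 / 100000`, `u = 263 / 10000`; `P_5(K̄₂BT·a) = 0.9929 < 1`; `K₂B` column `—`, sharp Bakry–Émery `1/40`). [folklore] -/
theorem massGapAt_SU_five_levelTwoBT_fifty (hN : 50 ≤ N) {x : ℝ} (h : |x| ≤ 41 / 1200) : MassGapAt 5 N x := by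
  have hR : |x| * (2 * (((5 : ℕ) : ℝ) - 1)) ≤ 41 / 150 := by push_cast; linarith only [h]
  have hmod := levelTwoBT_bracket_local (N₀ := 50) (N := N) (by norm_num) hN (R₀ := 41 / 150) (q := 691 / 5000) (p := 17 / 20)
    (t := 7923 / 100000) (u := 263 / 10000) (by norm_num) (by norm_num) (by norm_num) (by norm_num) (by norm_num) (by norm_num) (by norm_num)
    (by norm_num) (by norm_num) (by norm_num)
  refine StarDimMassGap.massGapAt_of_oneLinkKRModulus (d := 5) (by norm_num) (by omega) ?_ hR hmod
    (dim_door_of_le (d := 5) (by norm_num) ?_ h (abs_nonneg x) ?_) <;> norm_num [doorPoly]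

/-- **`ImprovedThreshold 5 N (41 / 1200)` for every `N ≥ 50`, hypothesis-free** (`0.0342`). [folklore] -/
theorem improvedThreshold_SU_five_levelTwoBT_fifty (hN : 50 ≤ N) : ImprovedThreshold 5 N (41 / 1200) :=
  ⟨by norm_num, fun _ hx => massGapAt_SU_five_levelTwoBT_fifty hN hx.le⟩

/-! ### `d = 6` -/

/-- **`SU(N)`, `N ≥ 6`, `d = 6`**: `MassGapAt 6 N x` at every 't Hooft `|x| ≤ 31 / 1250 = 0.0248`, hypothesis-free (bracket `N₀ = 6`,
`R₀ = 31 / 125`, `q = 1039 / 5000`, `p = 863 / 1000`, `t = 10611 / 100000`, `u = 949 / 20000`; `P_6(K̄₂BT·a) = 0.9890 < 1`; `K₂B` column `49/2000`, sharp Bakry–Émery `1/48`). [folklore] -/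
theorem massGapAt_SU_six_levelTwoBT_six (hN : 6 ≤ N) {x : ℝ} (h : |x| ≤ 31 / 1250) : MassGapAt 6 N x := by
  have hR : |x| * (2 * (((6 : ℕ) : ℝ) - 1)) ≤ 31 / 125 := by push_cast; linarith only [h]
  have hmod := levelTwoBT_bracket_local (N₀ := 6) (N := N) (by norm_num) hN (R₀ := 31 / 125) (q := 1039 / 5000) (p := 863 / 1000)
    (t := 10611 / 100000) (u := 949 / 20000) (by norm_num) (by norm_num) (by norm_num) (by norm_num) (by norm_num) (by norm_num) (by norm_num)
    (by norm_num) (by norm_num) (by norm_num)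
  refine StarDimMassGap.massGapAt_of_oneLinkKRModulus (d := 6) (by norm_num) (by omega) ?_ hR hmod
    (dim_door_of_le (d := 6) (by norm_num) ?_ h (abs_nonneg x) ?_) <;> norm_num [doorPoly]

/-- **`ImprovedThreshold 6 N (31 / 1250)` for every `N ≥ 6`, hypothesis-free** (`0.0248`). [folklore] -/
theorem improvedThreshold_SU_six_levelTwoBT_six (hN : 6 ≤ N) : ImprovedThreshold 6 N (31 / 1250) :=
  ⟨by norm_num, fun _ hx => massGapAt_SU_six_levelTwoBT_six hN hx.le⟩

/-- **`SU(N)`, `N ≥ 10`, `d = 6`**: `MassGapAt 6 N x` at every 't Hooft `|x| ≤ 13 / 500 = 0.0260`, hypothesis-free (bracket `N₀ = 10`,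
`R₀ = 13 / 50`, `q = 1641 / 10000`, `p = 8519 / 10000`, `t = 8857 / 100000`, `u = 1773 / 50000`; `P_6(K̄₂BT·a) = 0.9646 < 1`; `K₂B` column `16/625`, sharp Bakry–Émery `1/48`). [folklore] -/
theorem massGapAt_SU_six_levelTwoBT_ten (hN : 10 ≤ N) {x : ℝ} (h : |x| ≤ 13 / 500) : MassGapAt 6 N x := by
  have hR : |x| * (2 * (((6 : ℕ) : ℝ) - 1)) ≤ 13 / 50 := by push_cast; linarith only [h]
  have hmod := levelTwoBT_bracket_local (N₀ := 10) (N := N) (by norm_num) hN (R₀ := 13 / 50) (q := 1641 / 10000) (p := 8519 / 10000)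
    (t := 8857 / 100000) (u := 1773 / 50000) (by norm_num) (by norm_num) (by norm_num) (by norm_num) (by norm_num) (by norm_num) (by norm_num)
    (by norm_num) (by norm_num) (by norm_num)
  refine StarDimMassGap.massGapAt_of_oneLinkKRModulus (d := 6) (by norm_num) (by omega) ?_ hR hmod
    (dim_door_of_le (d := 6) (by norm_num) ?_ h (abs_nonneg x) ?_) <;> norm_num [doorPoly]

/-- **`ImprovedThreshold 6 N (13 / 500)` for every `N ≥ 10`, hypothesis-free** (`0.0260`). [folklore] -/
theorem improvedThreshold_SU_six_levelTwoBT_ten (hN : 10 ≤ N) : ImprovedThreshold 6 N (13 / 500) :=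
  ⟨by norm_num, fun _ hx => massGapAt_SU_six_levelTwoBT_ten hN hx.le⟩

/-- **`SU(N)`, `N ≥ 20`, `d = 6`**: `MassGapAt 6 N x` at every 't Hooft `|x| ≤ 27 / 1000 = 0.0270`, hypothesis-free (bracket `N₀ = 20`,
`R₀ = 27 / 100`, `q = 18 / 125`, `p = 4251 / 5000`, `t = 1017 / 12500`, `u = 717 / 25000`; `P_6(K̄₂BT·a) = 0.9942 < 1`; `K₂B` column `13/500`, sharp Bakry–Émery `1/48`). [folklore] -/
theorem massGapAt_SU_six_levelTwoBT_twenty (hN : 20 ≤ N) {x : ℝ} (h : |x| ≤ 27 / 1000) : MassGapAt 6 N x := by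
  have hR : |x| * (2 * (((6 : ℕ) : ℝ) - 1)) ≤ 27 / 100 := by push_cast; linarith only [h]
  have hmod := levelTwoBT_bracket_local (N₀ := 20) (N := N) (by norm_num) hN (R₀ := 27 / 100) (q := 18 / 125) (p := 4251 / 5000)
    (t := 1017 / 12500) (u := 717 / 25000) (by norm_num) (by norm_num) (by norm_num) (by norm_num) (by norm_num) (by norm_num) (by norm_num)
    (by norm_num) (by norm_num) (by norm_num)
  refine StarDimMassGap.massGapAt_of_oneLinkKRModulus (d := 6) (by norm_num) (by omega) ?_ hR hmod
    (dim_door_of_le (d := 6) (by norm_num) ?_ h (abs_nonneg x) ?_) <;> norm_num [doorPoly]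

/-- **`ImprovedThreshold 6 N (27 / 1000)` for every `N ≥ 20`, hypothesis-free** (`0.0270`). [folklore] -/
theorem improvedThreshold_SU_six_levelTwoBT_twenty (hN : 20 ≤ N) : ImprovedThreshold 6 N (27 / 1000) :=
  ⟨by norm_num, fun _ hx => massGapAt_SU_six_levelTwoBT_twenty hN hx.le⟩

/-- **`SU(N)`, `N ≥ 50`, `d = 6`**: `MassGapAt 6 N x` at every 't Hooft `|x| ≤ 17 / 625 = 0.0272`, hypothesis-free (bracket `N₀ = 50`,
`R₀ = 34 / 125`, `q = 11 / 80`, `p = 8491 / 10000`, `t = 1569 / 20000`, `u = 2601 / 100000`; `P_6(K̄₂BT·a) = 0.9896 < 1`; `K₂B` column `—`, sharp Bakry–Émery `1/48`). [folklore] -/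
theorem massGapAt_SU_six_levelTwoBT_fifty (hN : 50 ≤ N) {x : ℝ} (h : |x| ≤ 17 / 625) : MassGapAt 6 N x := by
  have hR : |x| * (2 * (((6 : ℕ) : ℝ) - 1)) ≤ 34 / 125 := by push_cast; linarith only [h]
  have hmod := levelTwoBT_bracket_local (N₀ := 50) (N := N) (by norm_num) hN (R₀ := 34 / 125) (q := 11 / 80) (p := 8491 / 10000)
    (t := 1569 / 20000) (u := 2601 / 100000) (by norm_num) (by norm_num) (by norm_num) (by norm_num) (by norm_num) (by norm_num) (by norm_num)
    (by norm_num) (by norm_num) (by norm_num)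
  refine StarDimMassGap.massGapAt_of_oneLinkKRModulus (d := 6) (by norm_num) (by omega) ?_ hR hmod
    (dim_door_of_le (d := 6) (by norm_num) ?_ h (abs_nonneg x) ?_) <;> norm_num [doorPoly]

/-- **`ImprovedThreshold 6 N (17 / 625)` for every `N ≥ 50`, hypothesis-free** (`0.0272`). [folklore] -/
theorem improvedThreshold_SU_six_levelTwoBT_fifty (hN : 50 ≤ N) : ImprovedThreshold 6 N (17 / 625) :=
  ⟨by norm_num, fun _ hx => massGapAt_SU_six_levelTwoBT_fifty hN hx.le⟩

/-! ### `d = 7` -/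

/-- **`SU(N)`, `N ≥ 10`, `d = 7`**: `MassGapAt 7 N x` at every 't Hooft `|x| ≤ 13 / 600 = 0.0217`, hypothesis-free (bracket `N₀ = 10`,
`R₀ = 13 / 50`, `q = 1641 / 10000`, `p = 8519 / 10000`, `t = 8857 / 100000`, `u = 1773 / 50000`; `P_7(K̄₂BT·a) = 0.9730 < 1`; `K₂B` column `53/2500`, sharp Bakry–Émery `1/56`). [folklore] -/
theorem massGapAt_SU_seven_levelTwoBT_ten (hN : 10 ≤ N) {x : ℝ} (h : |x| ≤ 13 / 600) : MassGapAt 7 N x := by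
  have hR : |x| * (2 * (((7 : ℕ) : ℝ) - 1)) ≤ 13 / 50 := by push_cast; linarith only [h]
  have hmod := levelTwoBT_bracket_local (N₀ := 10) (N := N) (by norm_num) hN (R₀ := 13 / 50) (q := 1641 / 10000) (p := 8519 / 10000)
    (t := 8857 / 100000) (u := 1773 / 50000) (by norm_num) (by norm_num) (by norm_num) (by norm_num) (by norm_num) (by norm_num) (by norm_num)
    (by norm_num) (by norm_num) (by norm_num)
  refine StarDimMassGap.massGapAt_of_oneLinkKRModulus (d := 7) (by norm_num) (by omega) ?_ hR hmod
    (dim_door_of_le (d := 7) (by norm_num) ?_ h (abs_nonneg x) ?_) <;> norm_num [doorPoly]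

/-- **`ImprovedThreshold 7 N (13 / 600)` for every `N ≥ 10`, hypothesis-free** (`0.0217`). [folklore] -/
theorem improvedThreshold_SU_seven_levelTwoBT_ten (hN : 10 ≤ N) : ImprovedThreshold 7 N (13 / 600) :=
  ⟨by norm_num, fun _ hx => massGapAt_SU_seven_levelTwoBT_ten hN hx.le⟩

/-- **`SU(N)`, `N ≥ 20`, `d = 7`**: `MassGapAt 7 N x` at every 't Hooft `|x| ≤ 14 / 625 = 0.0224`, hypothesis-free (bracket `N₀ = 20`,
`R₀ = 168 / 625`, `q = 717 / 5000`, `p = 4247 / 5000`, `t = 4033 / 50000`, `u = 2843 / 100000`; `P_7(K̄₂BT·a) = 0.9886 < 1`; `K₂B` column `27/1250`, sharp Bakry–Émery `1/56`). [folklore] -/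
theorem massGapAt_SU_seven_levelTwoBT_twenty (hN : 20 ≤ N) {x : ℝ} (h : |x| ≤ 14 / 625) : MassGapAt 7 N x := by
  have hR : |x| * (2 * (((7 : ℕ) : ℝ) - 1)) ≤ 168 / 625 := by push_cast; linarith only [h]
  have hmod := levelTwoBT_bracket_local (N₀ := 20) (N := N) (by norm_num) hN (R₀ := 168 / 625) (q := 717 / 5000) (p := 4247 / 5000)
    (t := 4033 / 50000) (u := 2843 / 100000) (by norm_num) (by norm_num) (by norm_num) (by norm_num) (by norm_num) (by norm_num) (by norm_num)
    (by norm_num) (by norm_num) (by norm_num)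
  refine StarDimMassGap.massGapAt_of_oneLinkKRModulus (d := 7) (by norm_num) (by omega) ?_ hR hmod
    (dim_door_of_le (d := 7) (by norm_num) ?_ h (abs_nonneg x) ?_) <;> norm_num [doorPoly]

/-- **`ImprovedThreshold 7 N (14 / 625)` for every `N ≥ 20`, hypothesis-free** (`0.0224`). [folklore] -/
theorem improvedThreshold_SU_seven_levelTwoBT_twenty (hN : 20 ≤ N) : ImprovedThreshold 7 N (14 / 625) :=
  ⟨by norm_num, fun _ hx => massGapAt_SU_seven_levelTwoBT_twenty hN hx.le⟩

/-- **`SU(N)`, `N ≥ 50`, `d = 7`**: `MassGapAt 7 N x` at every 't Hooft `|x| ≤ 9 / 400 = 0.0225`, hypothesis-free (bracket `N₀ = 50`,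
`R₀ = 27 / 100`, `q = 273 / 2000`, `p = 8477 / 10000`, `t = 773 / 10000`, `u = 2559 / 100000`; `P_7(K̄₂BT·a) = 0.9750 < 1`; `K₂B` column `—`, sharp Bakry–Émery `1/56`). [folklore] -/
theorem massGapAt_SU_seven_levelTwoBT_fifty (hN : 50 ≤ N) {x : ℝ} (h : |x| ≤ 9 / 400) : MassGapAt 7 N x := by
  have hR : |x| * (2 * (((7 : ℕ) : ℝ) - 1)) ≤ 27 / 100 := by push_cast; linarith only [h]
  have hmod := levelTwoBT_bracket_local (N₀ := 50) (N := N) (by norm_num) hN (R₀ := 27 / 100) (q := 273 / 2000) (p := 8477 / 10000)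
    (t := 773 / 10000) (u := 2559 / 100000) (by norm_num) (by norm_num) (by norm_num) (by norm_num) (by norm_num) (by norm_num) (by norm_num)
    (by norm_num) (by norm_num) (by norm_num)
  refine StarDimMassGap.massGapAt_of_oneLinkKRModulus (d := 7) (by norm_num) (by omega) ?_ hR hmod
    (dim_door_of_le (d := 7) (by norm_num) ?_ h (abs_nonneg x) ?_) <;> norm_num [doorPoly]

/-- **`ImprovedThreshold 7 N (9 / 400)` for every `N ≥ 50`, hypothesis-free** (`0.0225`). [folklore] -/
theorem improvedThreshold_SU_seven_levelTwoBT_fifty (hN : 50 ≤ N) : ImprovedThreshold 7 N (9 / 400) :=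
  ⟨by norm_num, fun _ hx => massGapAt_SU_seven_levelTwoBT_fifty hN hx.le⟩

/-! ### `d = 8` -/

/-- **`SU(N)`, `N ≥ 10`, `d = 8`**: `MassGapAt 8 N x` at every 't Hooft `|x| ≤ 37 / 2000 = 0.0185`, hypothesis-free (bracket `N₀ = 10`,
`R₀ = 259 / 1000`, `q = 1637 / 10000`, `p = 532 / 625`, `t = 11 / 125`, `u = 141 / 4000`; `P_8(K̄₂BT·a) = 0.9678 < 1`; `K₂B` column `9/500`, sharp Bakry–Émery `1/64`). [folklore] -/
theorem massGapAt_SU_eight_levelTwoBT_ten (hN : 10 ≤ N) {x : ℝ} (h : |x| ≤ 37 / 2000) : MassGapAt 8 N x := by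
  have hR : |x| * (2 * (((8 : ℕ) : ℝ) - 1)) ≤ 259 / 1000 := by push_cast; linarith only [h]
  have hmod := levelTwoBT_bracket_local (N₀ := 10) (N := N) (by norm_num) hN (R₀ := 259 / 1000) (q := 1637 / 10000) (p := 532 / 625)
    (t := 11 / 125) (u := 141 / 4000) (by norm_num) (by norm_num) (by norm_num) (by norm_num) (by norm_num) (by norm_num) (by norm_num)
    (by norm_num) (by norm_num) (by norm_num)
  refine StarDimMassGap.massGapAt_of_oneLinkKRModulus (d := 8) (by norm_num) (by omega) ?_ hR hmod
    (dim_door_of_le (d := 8) (by norm_num) ?_ h (abs_nonneg x) ?_) <;> norm_num [doorPoly]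

/-- **`ImprovedThreshold 8 N (37 / 2000)` for every `N ≥ 10`, hypothesis-free** (`0.0185`). [folklore] -/
theorem improvedThreshold_SU_eight_levelTwoBT_ten (hN : 10 ≤ N) : ImprovedThreshold 8 N (37 / 2000) :=
  ⟨by norm_num, fun _ hx => massGapAt_SU_eight_levelTwoBT_ten hN hx.le⟩

/-- **`SU(N)`, `N ≥ 20`, `d = 8`**: `MassGapAt 8 N x` at every 't Hooft `|x| ≤ 12 / 625 = 0.0192`, hypothesis-free (bracket `N₀ = 20`,
`R₀ = 168 / 625`, `q = 717 / 5000`, `p = 4247 / 5000`, `t = 4033 / 50000`, `u = 2843 / 100000`; `P_8(K̄₂BT·a) = 0.9946 < 1`; `K₂B` column `37/2000`, sharp Bakry–Émery `1/64`). [folklore] -/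
theorem massGapAt_SU_eight_levelTwoBT_twenty (hN : 20 ≤ N) {x : ℝ} (h : |x| ≤ 12 / 625) : MassGapAt 8 N x := by
  have hR : |x| * (2 * (((8 : ℕ) : ℝ) - 1)) ≤ 168 / 625 := by push_cast; linarith only [h]
  have hmod := levelTwoBT_bracket_local (N₀ := 20) (N := N) (by norm_num) hN (R₀ := 168 / 625) (q := 717 / 5000) (p := 4247 / 5000)
    (t := 4033 / 50000) (u := 2843 / 100000) (by norm_num) (by norm_num) (by norm_num) (by norm_num) (by norm_num) (by norm_num) (by norm_num)
    (by norm_num) (by norm_num) (by norm_num)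
  refine StarDimMassGap.massGapAt_of_oneLinkKRModulus (d := 8) (by norm_num) (by omega) ?_ hR hmod
    (dim_door_of_le (d := 8) (by norm_num) ?_ h (abs_nonneg x) ?_) <;> norm_num [doorPoly]

/-- **`ImprovedThreshold 8 N (12 / 625)` for every `N ≥ 20`, hypothesis-free** (`0.0192`). [folklore] -/
theorem improvedThreshold_SU_eight_levelTwoBT_twenty (hN : 20 ≤ N) : ImprovedThreshold 8 N (12 / 625) :=
  ⟨by norm_num, fun _ hx => massGapAt_SU_eight_levelTwoBT_twenty hN hx.le⟩

/-- The `d = 3` ladder arithmetic against the `K₂B` ladder and the sharp Bakry–Émery `1/24`: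
`1/24 < 143/2500 < 36/625`, `1/16 < 159/2500`, `41/625 < 42/625`, `67/1000 < 69/1000 < 87/1250 < 1/8`. [folklore] -/
theorem threshold_ladder_levelTwoBT_dim :
    (1 : ℝ) / 24 < 143 / 2500 ∧ (143 : ℝ) / 2500 < 36 / 625 ∧ (1 : ℝ) / 16 < 159 / 2500 ∧ (41 : ℝ) / 625 < 42 / 625 ∧
      (67 : ℝ) / 1000 < 69 / 1000 ∧ (69 : ℝ) / 1000 < 87 / 1250 ∧ (87 : ℝ) / 1250 < 1 / 8 := by
  norm_num

end LevelTwoBTDimRows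

end Summit.Ventures.YMGap.OneLinkEigen
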